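import Mathlib
import Summits.KontsevichZagierPeriods.KontsevichZagierPeriods.Theses.InverseLandau
import Summits.KontsevichZagierPeriods.KontsevichZagierPeriods.Theorems.InverseLandauTateLiftingRatPolyDense
import Summits.KontsevichZagierPeriods.KontsevichZagierPeriods.Theorems.InverseLandauTateLiftingPolynomialArc
import Summits.KontsevichZagierPeriods.KontsevichZagierPeriods.Theorems.InverseLandauTateLiftingCornerShift
import Summits.KontsevichZagierPeriods.KontsevichZagierPeriods.Theorems.InverseLandauTateLiftingTateSubst
import Summits.KontsevichZagierPeriods.KontsevichZagierPeriods.Theorems.InverseLandauTateLiftingArcSpecialisation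

/-!
# `TateLifting` (stmt-KontsevichZagierPeriods-9129), line `Sketch` — the transfer, assembled

PRESENTATION LIFTING IS FREE. Unconditionally (all five elementary stubs of the line are landed:
`tateLifting_ratPolyDense`, `tateLifting_polynomialArc`, `tateLifting_cornerShift`,
`tateLifting_tateSubst`, `tateLifting_arcSpecialisation`):

* `tateLifting_genFibres_subset_tateFibres` — every GENERIC FIBRE (the specialisation
  `[(0,1)ⁿ, P/Q(·;a)]` of a `k`-parameter rational vanishing identity with a Tate corner, at a point
  `a` with real-algebraic coordinates joined to the corner by a path inside the open admissible
  vanishing region `U`) is a TATE FIBRE of the crux (a fibre at a real-algebraic parameter of a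
  ONE-parameter rational Tate family over `ℚ`, admissible and identically vanishing on `(0,ε)`);
* `TateLifting_of_genLifting` — hence the crux `TateLifting` follows from the GENERATION statement
  `GenLifting : ker eval ⊆ relations ⊔ closure 𝒢` (conjecture-grade; the exact residual of the line,
  recorded as stub `stub_genLifting` of `Cruxes/TateLifting/Lines/Sketch.lean`).

So the one-parameter / rational-over-`ℚ` / algebraic-point phrasing of the crux's generating set costs
nothing: multi-parameter corner-anchored functional equations (the route's own `FiveTermCertificate`,
loop relators along arcs, Stokes generators with polynomial parameters) specialised at ANY algebraic
point of their admissible region are already in `closure T`.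
-/

noncomputable section

namespace Summit.KontsevichZagierPeriods.InverseLandau

open Literature.NumberTheory.Transcendental

/-- **Generic fibres are Tate fibres** (unconditional): the specialisation at a real-algebraic
parameter point `a ∈ U`, joined to the corner `0` by a path in the open region `U`, of a
`k`-parameter rational family `P/Q(z;u)` with Tate corner `Q(z;0) ≡ c₀ ≠ 0`, admissible on
`[0,1]ⁿ × U` and with vanishing cube integral for every `u ∈ U`, is the fibre at a real-algebraic
`ϖ₀ ∈ (0,ε)` of a one-parameter rational Tate family over `ℚ`, admissible and identically vanishing
on `(0,ε)` — i.e. an element of the generating set of `TateLifting`. [folklore] -/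
theorem tateLifting_genFibres_subset_tateFibres :
    {d : KZ.FormalRep | ∃ (n k : ℕ) (P Q : MvPolynomial (Fin (n + k)) ℚ) (U : Set (Fin k → ℝ))
        (γ : ℝ → (Fin k → ℝ)) (a : Fin k → ℝ) (r : KZ.IntegralRep n),
      IsOpen U ∧ ContinuousOn γ (Set.Icc 0 1) ∧ γ 0 = 0 ∧ γ 1 = a ∧
      (∀ t ∈ Set.Icc (0 : ℝ) 1, γ t ∈ U) ∧
      (∃ c₀ : ℚ, c₀ ≠ 0 ∧ ∀ z : Fin n → ℝ,
        MvPolynomial.aeval (Fin.append z (0 : Fin k → ℝ)) Q = (c₀ : ℝ)) ∧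
      (∀ (z : Fin n → ℝ) (u : Fin k → ℝ), (∀ i, z i ∈ Set.Icc (0 : ℝ) 1) → u ∈ U →
        MvPolynomial.aeval (Fin.append z u) Q ≠ 0) ∧
      (∀ u ∈ U, ∫ z in Set.pi Set.univ (fun _ : Fin n => Set.Ioo (0 : ℝ) 1),
        MvPolynomial.aeval (Fin.append z u) P / MvPolynomial.aeval (Fin.append z u) Q = 0) ∧
      (∀ j, IsAlgebraic ℚ (a j)) ∧
      r.domain = Set.pi Set.univ (fun _ : Fin n => Set.Ioo (0 : ℝ) 1) ∧
      Set.EqOn r.integrand (fun z => MvPolynomial.aeval (Fin.append z a) P /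
        MvPolynomial.aeval (Fin.append z a) Q) r.domain ∧
      d = KZ.of r} ⊆
    {d : KZ.FormalRep | ∃ (n : ℕ) (P Q : MvPolynomial (Fin (n + 1)) ℚ) (ε ϖ₀ : ℝ)
        (r : KZ.IntegralRep n), 0 < ε ∧
      (∃ c₀ : ℚ, c₀ ≠ 0 ∧ ∀ z : Fin n → ℝ,
        MvPolynomial.aeval (Fin.snoc z (0 : ℝ) : Fin (n + 1) → ℝ) Q = (c₀ : ℝ)) ∧
      (∀ (z : Fin n → ℝ) (ϖ : ℝ), (∀ i, z i ∈ Set.Icc (0 : ℝ) 1) → ϖ ∈ Set.Ioo 0 ε →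
        MvPolynomial.aeval (Fin.snoc z ϖ : Fin (n + 1) → ℝ) Q ≠ 0) ∧
      (∀ ϖ ∈ Set.Ioo (0 : ℝ) ε, ∫ z in Set.pi Set.univ (fun _ : Fin n => Set.Ioo (0 : ℝ) 1),
        MvPolynomial.aeval (Fin.snoc z ϖ : Fin (n + 1) → ℝ) P /
          MvPolynomial.aeval (Fin.snoc z ϖ : Fin (n + 1) → ℝ) Q = 0) ∧
      IsAlgebraic ℚ ϖ₀ ∧ ϖ₀ ∈ Set.Ioo 0 ε ∧
      r.domain = Set.pi Set.univ (fun _ : Fin n => Set.Ioo (0 : ℝ) 1) ∧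
      Set.EqOn r.integrand (fun z => MvPolynomial.aeval (Fin.snoc z ϖ₀ : Fin (n + 1) → ℝ) P /
        MvPolynomial.aeval (Fin.snoc z ϖ₀ : Fin (n + 1) → ℝ) Q) r.domain ∧
      d = KZ.of r} :=
  tateLifting_arcSpecialisation tateLifting_cornerShift
    (tateLifting_polynomialArc tateLifting_ratPolyDense) tateLifting_tateSubst

/-- **The transfer of line `Sketch`**: the crux `TateLifting` follows from the generation statement
`GenLifting` — every formal combination with vanishing evaluation lies in `KZ.relations ⊔ closure 𝒢`,
`𝒢` the generic fibres — by `tateLifting_genFibres_subset_tateFibres`, monotonicity of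
`AddSubgroup.closure` and `sup_le`. (CONDITIONAL on its hypothesis, which is conjecture-grade: the
GPC-strength residue of the crux, itself implied by `KZKernelConjecture`.)
[cite: KontsevichZagier2001, §1.2] -/
theorem TateLifting_of_genLifting
    (hGen : ∀ c : KZ.FormalRep, KZ.eval c = 0 → c ∈ KZ.relations ⊔ AddSubgroup.closure
      {d : KZ.FormalRep | ∃ (n k : ℕ) (P Q : MvPolynomial (Fin (n + k)) ℚ) (U : Set (Fin k → ℝ))
          (γ : ℝ → (Fin k → ℝ)) (a : Fin k → ℝ) (r : KZ.IntegralRep n),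
        IsOpen U ∧ ContinuousOn γ (Set.Icc 0 1) ∧ γ 0 = 0 ∧ γ 1 = a ∧
        (∀ t ∈ Set.Icc (0 : ℝ) 1, γ t ∈ U) ∧
        (∃ c₀ : ℚ, c₀ ≠ 0 ∧ ∀ z : Fin n → ℝ,
          MvPolynomial.aeval (Fin.append z (0 : Fin k → ℝ)) Q = (c₀ : ℝ)) ∧
        (∀ (z : Fin n → ℝ) (u : Fin k → ℝ), (∀ i, z i ∈ Set.Icc (0 : ℝ) 1) → u ∈ U →
          MvPolynomial.aeval (Fin.append z u) Q ≠ 0) ∧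
        (∀ u ∈ U, ∫ z in Set.pi Set.univ (fun _ : Fin n => Set.Ioo (0 : ℝ) 1),
          MvPolynomial.aeval (Fin.append z u) P / MvPolynomial.aeval (Fin.append z u) Q = 0) ∧
        (∀ j, IsAlgebraic ℚ (a j)) ∧
        r.domain = Set.pi Set.univ (fun _ : Fin n => Set.Ioo (0 : ℝ) 1) ∧
        Set.EqOn r.integrand (fun z => MvPolynomial.aeval (Fin.append z a) P /
          MvPolynomial.aeval (Fin.append z a) Q) r.domain ∧
        d = KZ.of r}) :
    Summit.KontsevichZagierPeriods.KontsevichZagierPeriods.Theses.InverseLandau.TateLifting :=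
  fun c hc => sup_le le_sup_left
    ((AddSubgroup.closure_mono tateLifting_genFibres_subset_tateFibres).trans le_sup_right)
    (hGen c hc)

end Summit.KontsevichZagierPeriods.InverseLandau

end
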